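import Summits.AtomisticToContinuum.HydrodynamicLimit.Theorems.RingDensityCertificateSmallDataRingSparsityTiltStatics
import Summits.AtomisticToContinuum.HydrodynamicLimit.Theorems.RingDensityCertificateSmallDataRingSparsity
import HarnessLib

/-!
# Quantitative Cauchy–Schwarz tilt for near-constant local Gibbs data
# (`SmallDataRingSparsity`, stmt-AtomisticToContinuum-12132, route `RingDensityCertificate`; file 2 of 2)

Helper file (`--supports stmt-AtomisticToContinuum-12132`). It PROVES hypothesis (2) of
`SmallDataRingSparsity.smallDataRingSparsity_hFirst_of`
(`Theorems/RingDensityCertificateSmallDataRingSparsity.lean`): for `c, θc > 0`, `0 < σ < 1/4` and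
EVERY rate `Λ > 0` there is an amplitude `η₀ > 0` such that for continuous positive profiles within
`η₀` of `(c, 0, θc)`, `P_N(B) ≤ e^{Λ(N+1)} Q_N(B)^{1/2}` for all `N`, flows and measurable `B`
(`quantTiltTransfer`). With it, the `h`-first form of the item waits only for `EquilibriumRingLD`
(stmt-12130) and the smallness of the equilibrium ring fraction.

* `posPartition_le_pow_mul`, `pow_mul_posPartition_one_le_posPartition` — `Z_pos[ã] ≤ (sup ã)ⁿ Z_pos[1]`
  and `(inf a₀)ⁿ Z_pos[1] ≤ Z_pos[a₀]`, so `Z_pos[1] Z_pos[ã]/Z_pos[a₀]² ≤ (sup ã/(inf a₀)²)ⁿ`;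
* `exists_amplitude` — `R(η) = (c+η)² (θc²/(θc-η)²)^{3/2} e^{η²/(θc-η)} / (c-η)²` is continuous at
  `0` with value `1`, whence `η₀ ∈ (0, min(c,θc)/2)` with `R(η₀) ≤ e^{2Λ}`;
* `quantTiltTransfer` — the statement, from the static transfer
  `localGibbsLaw_le_sqrt_mul_rpow_half` with the exact tilted profile `localGibbsProfile_sq_eq` of
  file 1 and `sup ã ≤ (c+η₀)² (θc²/(θc-η₀)²)^{3/2} e^{η₀²/(θc-η₀)}`;
* `smallDataRingSparsity_hFirst_of_ringLD`, `smallDataRingSparsity_hFirst_of_sparsityLD` — the two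
  repairs of the item for the planner: the `h`-first decl from `EquilibriumRingLD` (stmt-12130) plus
  eventual smallness `r_E(N) ≤ δ` of the equilibrium ring fraction, or from a single equilibrium
  large-deviation bound for the ring-excess event `{δ Z_coll < Z_ring}`.

Deliberately not here: the route item `TiltTransfer` (stmt-12131; unquantified `Λ`, all times via
`HomogeneousInvariance`), which is another seat's and does not suffice for the small-data argument.

References: C. Kipnis, C. Landim, *Scaling Limits of Interacting Particle Systems* (1999), App. 1 §8,
Ch. 10; H. Spohn, *Large Scale Dynamics of Interacting Particles* (1991), Part I §2.3.
-/

noncomputable section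

namespace Summit.AtomisticToContinuum.HydrodynamicLimit.Theorems

namespace SmallDataRingSparsity

open MeasureTheory Filter Set Topology Real
open scoped ENNReal
open Literature.Analysis.FluidPDE Literature.MathematicalPhysics.KineticTheory

/-! ### Configurational partition functions: comparison with the field-free one -/

/-- `Z_pos[a₀] ≤ Aⁿ Z_pos[1]` for `0 ≤ a₀ ≤ A`. [folklore] -/
theorem posPartition_le_pow_mul {a₀ : T3 → ℝ} (ha : Continuous a₀) (ha0 : ∀ x, 0 ≤ a₀ x) {A : ℝ}
    (hA : ∀ x, a₀ x ≤ A) (ε : ℝ) (n : ℕ) :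
    posPartition a₀ ε n ≤ A ^ n * posPartition 1 ε n := by
  rw [posPartition, posPartition, ← integral_const_mul]
  refine integral_mono (integrable_posWeight ha ha0 ε n)
    ((integrable_posWeight continuous_one (fun _ => zero_le_one) ε n).const_mul _) fun x => ?_
  simp only [posWeight]
  by_cases hx : x ∈ posDomain ε n
  · rw [Set.indicator_of_mem hx, Set.indicator_of_mem hx]
    simp only [Pi.one_apply, Finset.prod_const_one, mul_one]
    have hA0 : 0 ≤ A := (ha0 0).trans (hA 0)
    calc ∏ i, a₀ (x i) ≤ ∏ _i : Fin n, A :=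
          Finset.prod_le_prod (fun i _ => ha0 _) (fun i _ => hA _)
      _ = A ^ n := by simp
  · rw [Set.indicator_of_notMem hx, Set.indicator_of_notMem hx, mul_zero]

/-- `aⁿ Z_pos[1] ≤ Z_pos[a₀]` for `0 ≤ a ≤ a₀`. [folklore] -/
theorem pow_mul_posPartition_one_le_posPartition {a₀ : T3 → ℝ} (ha : Continuous a₀)
    (ha0 : ∀ x, 0 ≤ a₀ x) {a : ℝ} (ha_nn : 0 ≤ a) (haa : ∀ x, a ≤ a₀ x) (ε : ℝ) (n : ℕ) :
    a ^ n * posPartition 1 ε n ≤ posPartition a₀ ε n := by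
  rw [posPartition, posPartition, ← integral_const_mul]
  refine integral_mono ((integrable_posWeight continuous_one (fun _ => zero_le_one) ε n).const_mul _)
    (integrable_posWeight ha ha0 ε n) fun x => ?_
  simp only [posWeight]
  by_cases hx : x ∈ posDomain ε n
  · rw [Set.indicator_of_mem hx, Set.indicator_of_mem hx]
    simp only [Pi.one_apply, Finset.prod_const_one, mul_one]
    calc a ^ n = ∏ _i : Fin n, a := by simp
      _ ≤ ∏ i, a₀ (x i) := Finset.prod_le_prod (fun i _ => ha_nn) (fun i _ => haa _)
  · rw [Set.indicator_of_notMem hx, Set.indicator_of_notMem hx, mul_zero]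

/-! ### The quantitative tilt: amplitude `η₀` for a prescribed exponential rate `Λ` -/

/-- The rate function of the amplitude: `R(η) = (c+η)² (θc²/(θc-η)²)^{d/2} e^{η²/(θc-η)} / (c-η)²`
is continuous at `η = 0` with value `1`, so for every `Λ > 0` some `η₀ ∈ (0, min(c,θc)/2)` has
`R(η₀) ≤ e^{2Λ}`. [folklore] -/
theorem exists_amplitude {c θc Λ : ℝ} (hc : 0 < c) (hθc : 0 < θc) (hΛ : 0 < Λ) :
    ∃ η₀ : ℝ, 0 < η₀ ∧ η₀ < c / 2 ∧ η₀ < θc / 2 ∧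
      (c + η₀) ^ 2 * ((θc ^ 2 / (θc - η₀) ^ 2) ^ ((Module.finrank ℝ V3 : ℝ) / 2) *
          Real.exp (η₀ ^ 2 / (θc - η₀))) / (c - η₀) ^ 2 ≤ Real.exp (2 * Λ) := by
  set R : ℝ → ℝ := fun η => (c + η) ^ 2 * ((θc ^ 2 / (θc - η) ^ 2) ^ ((Module.finrank ℝ V3 : ℝ) / 2) *
    Real.exp (η ^ 2 / (θc - η))) / (c - η) ^ 2 with hR
  have hcont : ContinuousAt R 0 := by
    simp only [hR]
    have h1 : ContinuousAt (fun η : ℝ => θc ^ 2 / (θc - η) ^ 2) 0 :=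
      continuousAt_const.div ((continuousAt_const.sub continuousAt_id).pow 2)
        (by simpa using hθc.ne')
    have h2 : ContinuousAt (fun η : ℝ => (θc ^ 2 / (θc - η) ^ 2) ^ ((Module.finrank ℝ V3 : ℝ) / 2))
        0 := h1.rpow_const (Or.inr (by positivity))
    have h3 : ContinuousAt (fun η : ℝ => Real.exp (η ^ 2 / (θc - η))) 0 :=
      ((continuousAt_id.pow 2).div (continuousAt_const.sub continuousAt_id)
        (by simpa using hθc.ne')).rexp
    have h4 : ContinuousAt (fun η : ℝ => (c + η) ^ 2) 0 := (continuousAt_const.add continuousAt_id).pow 2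
    exact (h4.mul (h2.mul h3)).div ((continuousAt_const.sub continuousAt_id).pow 2)
      (by simpa using hc.ne')
  have hR0 : R 0 = 1 := by
    simp only [hR, add_zero, sub_zero, div_self (pow_ne_zero 2 hθc.ne'), Real.one_rpow,
      zero_pow two_ne_zero, zero_div, Real.exp_zero, mul_one]
    exact div_self (pow_ne_zero 2 hc.ne')
  have hlt : R 0 < Real.exp (2 * Λ) := by
    rw [hR0]
    exact Real.one_lt_exp_iff.2 (by positivity)
  have hev : ∀ᶠ η in 𝓝 (0 : ℝ), R η < Real.exp (2 * Λ) := hcont.eventually_lt_const hlt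
  have hb : (0 : ℝ) < min (c / 2) (θc / 2) := by positivity
  obtain ⟨η₀, hη₀R, hη₀mem⟩ :=
    ((hev.filter_mono nhdsWithin_le_nhds).and (Ioo_mem_nhdsGT hb)).exists
  refine ⟨η₀, hη₀mem.1, lt_of_lt_of_le hη₀mem.2 (min_le_left _ _),
    lt_of_lt_of_le hη₀mem.2 (min_le_right _ _), hη₀R.le⟩

/-- **Quantitative Cauchy–Schwarz tilt for near-constant local Gibbs data** (hypothesis (2) of
`smallDataRingSparsity_hFirst_of`). For `c, θc > 0`, `0 < σ < 1/4` and every rate `Λ > 0` there is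
an amplitude `η₀ > 0` such that for all continuous positive profiles `(a₀, u₀, θ₀)` within `η₀` of
the constants `(c, 0, θc)`, every `N`, flow `Φ` and measurable `B`,
`P_N(B) ≤ e^{Λ(N+1)} · Q_N(B)^{1/2}`, `P_N = localGibbsLaw σ a₀ u₀ θ₀ N Φ`,
`Q_N = localGibbsLaw σ 1 0 θc N Φ`. Proof: the static transfer
`localGibbsLaw_le_sqrt_mul_rpow_half` with the EXACT tilted profile of `localGibbsProfile_sq_eq`,
and `Z_pos[1] Z_pos[ã] / Z_pos[a₀]² ≤ (sup ã / (c-η₀)²)^{N+1} ≤ R(η₀)^{N+1} ≤ e^{2Λ(N+1)}`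
(`exists_amplitude`). This is the quantitative form of the route's `TiltTransfer` (stmt-12131) at
time `0`; the amplitude must shrink with `Λ`, which is what the small-data argument consumes.
[folklore] -/
theorem quantTiltTransfer :
    ∀ (c θc σ : ℝ), 0 < c → 0 < θc → 0 < σ → σ < 1 / 4 → ∀ Λ : ℝ, 0 < Λ → ∃ η₀ : ℝ, 0 < η₀ ∧ ∀ (a₀
      θ₀ : UnitAddTorus (Fin 3) → ℝ) (u₀ : UnitAddTorus (Fin 3) → EuclideanSpace ℝ (Fin 3)),
      Continuous a₀ → Continuous θ₀ → Continuous u₀ → (∀ x, 0 < a₀ x) → (∀ x, 0 < θ₀ x) → (∀ x, |a₀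
      x - c| ≤ η₀ ∧ ‖u₀ x‖ ≤ η₀ ∧ |θ₀ x - θc| ≤ η₀) → ∀ (N : ℕ) (Φ :
      Literature.Analysis.FluidPDE.HardSphereFlow (Literature.Analysis.FluidPDE.Torus.geometry (Fin
      3)) (Literature.MathematicalPhysics.KineticTheory.hsDiameter σ N) (N + 1)) (B : Set
      (Literature.Analysis.FluidPDE.Config (N + 1) (Fin 3) (UnitAddTorus (Fin 3)))), MeasurableSet B
      → Literature.MathematicalPhysics.KineticTheory.localGibbsLaw σ a₀ u₀ θ₀ N Φ B ≤ ENNReal.ofReal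
      (Real.exp (Λ * (N + 1))) * (Literature.MathematicalPhysics.KineticTheory.localGibbsLaw σ 1 0
      (fun _ => θc) N Φ B) ^ (1 / 2 : ℝ) := by
  intro c θc σ hc hθc hσ hσ4 Λ hΛ
  obtain ⟨η₀, hη₀, hη₀c, hη₀θ, hRle⟩ := exists_amplitude hc hθc hΛ
  refine ⟨η₀, hη₀, ?_⟩
  intro a₀ θ₀ u₀ ha hθ hu ha0 hθ0 hclose N Φ B hB
  -- profile bounds
  have hcη : 0 < c - η₀ := by linarith
  have hθη : 0 < θc - η₀ := by linarith
  have haU : ∀ x, a₀ x ≤ c + η₀ := fun x => by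
    have := (abs_sub_le_iff.1 (hclose x).1).1; linarith
  have haL : ∀ x, c - η₀ ≤ a₀ x := fun x => by
    have := (abs_sub_le_iff.1 (hclose x).1).2; linarith
  have hθU : ∀ x, θ₀ x ≤ θc + η₀ := fun x => by
    have := (abs_sub_le_iff.1 (hclose x).2.2).1; linarith
  have hθL : ∀ x, θc - η₀ ≤ θ₀ x := fun x => by
    have := (abs_sub_le_iff.1 (hclose x).2.2).2; linarith
  have huU : ∀ x, ‖u₀ x‖ ≤ η₀ := fun x => (hclose x).2.1
  have h2θc : ∀ x, θ₀ x < 2 * θc := fun x => by linarith [hθU x]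
  have hgap : ∀ x, 0 < 2 * θc - θ₀ x := fun x => by linarith [h2θc x]
  have hgapL : ∀ x, θc - η₀ ≤ 2 * θc - θ₀ x := fun x => by linarith [hθU x]
  -- the tilted profile
  set d : ℝ := (Module.finrank ℝ V3 : ℝ) with hd
  have hd0 : 0 ≤ d / 2 := by rw [hd]; positivity
  set aR : T3 → ℝ := fun x => a₀ x ^ 2 * ((θc ^ 2 / (θ₀ x * (2 * θc - θ₀ x))) ^ (d / 2) *
    Real.exp (‖u₀ x‖ ^ 2 / (2 * θc - θ₀ x))) with haR_def
  set uR : T3 → V3 := fun x => (2 * θc / (2 * θc - θ₀ x)) • u₀ x with huR_def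
  set θR : T3 → ℝ := fun x => θ₀ x * θc / (2 * θc - θ₀ x) with hθR_def
  have hbase_cont : Continuous fun x => θc ^ 2 / (θ₀ x * (2 * θc - θ₀ x)) :=
    continuous_const.div (hθ.mul (continuous_const.sub hθ))
      fun x => (mul_pos (hθ0 x) (hgap x)).ne'
  have haR : Continuous aR := by
    refine (ha.pow 2).mul ((hbase_cont.rpow_const fun x => Or.inr hd0).mul
      (Real.continuous_exp.comp ((hu.norm.pow 2).div (continuous_const.sub hθ)
        fun x => (hgap x).ne')))
  have hθR : Continuous θR :=
    (hθ.mul continuous_const).div (continuous_const.sub hθ) fun x => (hgap x).ne'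
  have huR : Continuous uR :=
    (continuous_const.div (continuous_const.sub hθ) fun x => (hgap x).ne').smul hu
  have haR0 : ∀ x, 0 ≤ aR x := fun x => by
    simp only [haR_def]
    have := hθ0 x; have := hgap x
    positivity
  have hθR0 : ∀ x, 0 < θR x := fun x => by
    simp only [hθR_def]
    have := hθ0 x; have := hgap x
    positivity
  have hdom : ∀ y, localGibbsProfile a₀ u₀ θ₀ y ^ 2 ≤
      localGibbsProfile aR uR θR y * localGibbsProfile 1 0 (fun _ => θc) y :=
    fun y => (localGibbsProfile_sq_eq hθ0 h2θc y).le
  have hσ2 : σ ≤ 1 / 2 := by linarith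
  refine (localGibbsLaw_le_sqrt_mul_rpow_half ha hθ hu ha0 hθ0 haR hθR huR haR0 hθR0 hθc hdom
    hσ2 N Φ hB).trans (mul_le_mul' (ENNReal.ofReal_le_ofReal ?_) le_rfl)
  -- the partition-function ratio
  set ε := hsDiameter σ N with hε
  set Abar : ℝ := (c + η₀) ^ 2 * ((θc ^ 2 / (θc - η₀) ^ 2) ^ (d / 2) *
    Real.exp (η₀ ^ 2 / (θc - η₀))) with hAbar
  have haRle : ∀ x, aR x ≤ Abar := by
    intro x
    simp only [haR_def, hAbar]
    have hθx := hθ0 x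
    have hb1 : θc ^ 2 / (θ₀ x * (2 * θc - θ₀ x)) ≤ θc ^ 2 / (θc - η₀) ^ 2 := by
      refine div_le_div_of_nonneg_left (sq_nonneg _) (by positivity) ?_
      rw [sq]
      exact mul_le_mul (hθL x) (hgapL x) hθη.le hθx.le
    have hb2 : (θc ^ 2 / (θ₀ x * (2 * θc - θ₀ x))) ^ (d / 2) ≤ (θc ^ 2 / (θc - η₀) ^ 2) ^ (d / 2) :=
      Real.rpow_le_rpow (by have := hgap x; positivity) hb1 hd0
    have hb3 : ‖u₀ x‖ ^ 2 / (2 * θc - θ₀ x) ≤ η₀ ^ 2 / (θc - η₀) :=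
      div_le_div₀ (sq_nonneg _) (pow_le_pow_left₀ (norm_nonneg _) (huU x) 2) hθη (hgapL x)
    have hb4 : a₀ x ^ 2 ≤ (c + η₀) ^ 2 := pow_le_pow_left₀ (ha0 x).le (haU x) 2
    refine mul_le_mul hb4 (mul_le_mul hb2 (Real.exp_le_exp.2 hb3) (Real.exp_pos _).le
      (Real.rpow_nonneg (by positivity) _)) (by have := hgap x; positivity) (by positivity)
  have hZ1pos : 0 < posPartition (1 : T3 → ℝ) ε (N + 1) :=
    posPartition_pos continuous_one (fun _ => one_pos) hσ2 N
  have hZR : posPartition aR ε (N + 1) ≤ Abar ^ (N + 1) * posPartition 1 ε (N + 1) :=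
    posPartition_le_pow_mul haR haR0 haRle ε (N + 1)
  have hZP : (c - η₀) ^ (N + 1) * posPartition 1 ε (N + 1) ≤ posPartition a₀ ε (N + 1) :=
    pow_mul_posPartition_one_le_posPartition ha (fun x => (ha0 x).le) hcη.le haL ε (N + 1)
  have hZPpos : 0 < (c - η₀) ^ (N + 1) * posPartition 1 ε (N + 1) := by positivity
  have hAbar0 : 0 ≤ Abar := by rw [hAbar]; positivity
  have hratio : posPartition 1 ε (N + 1) * posPartition aR ε (N + 1) / posPartition a₀ ε (N + 1) ^ 2 ≤
      (Abar / (c - η₀) ^ 2) ^ (N + 1) := by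
    calc posPartition 1 ε (N + 1) * posPartition aR ε (N + 1) / posPartition a₀ ε (N + 1) ^ 2
        ≤ posPartition 1 ε (N + 1) * (Abar ^ (N + 1) * posPartition 1 ε (N + 1)) /
            ((c - η₀) ^ (N + 1) * posPartition 1 ε (N + 1)) ^ 2 :=
          div_le_div₀ (by positivity) (mul_le_mul_of_nonneg_left hZR hZ1pos.le) (by positivity)
            (pow_le_pow_left₀ hZPpos.le hZP 2)
      _ = (Abar / (c - η₀) ^ 2) ^ (N + 1) := by
          have hZ1ne : posPartition (1 : T3 → ℝ) ε (N + 1) ≠ 0 := hZ1pos.ne'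
          have hy : (c - η₀) ^ (N + 1) ≠ 0 := pow_ne_zero _ hcη.ne'
          rw [div_pow, pow_right_comm (c - η₀) 2 (N + 1)]
          generalize (c - η₀) ^ (N + 1) = y at hy ⊢
          generalize posPartition (1 : T3 → ℝ) ε (N + 1) = Z at hZ1ne ⊢
          field_simp
  have hRpow : (Abar / (c - η₀) ^ 2) ^ (N + 1) ≤ Real.exp (Λ * (N + 1)) ^ 2 := by
    have h1 : Abar / (c - η₀) ^ 2 ≤ Real.exp (2 * Λ) := by rw [hAbar]; exact hRle
    calc (Abar / (c - η₀) ^ 2) ^ (N + 1) ≤ Real.exp (2 * Λ) ^ (N + 1) :=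
          pow_le_pow_left₀ (by positivity) h1 _
      _ = Real.exp (Λ * (N + 1)) ^ 2 := by
          rw [← Real.exp_nat_mul, ← Real.exp_nat_mul]
          congr 1
          push_cast
          ring
  calc Real.sqrt (posPartition 1 ε (N + 1) * posPartition aR ε (N + 1) / posPartition a₀ ε (N + 1) ^ 2)
      ≤ Real.sqrt (Real.exp (Λ * (N + 1)) ^ 2) := Real.sqrt_le_sqrt (hratio.trans hRpow)
    _ = Real.exp (Λ * (N + 1)) := Real.sqrt_sq (Real.exp_pos _).le

/-! ### The `h`-first form of the item from `EquilibriumRingLD` and ring-fraction smallness alone -/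

/-- **`SmallDataRingSparsity`, `h`-first form, from the two remaining equilibrium inputs.** With the
quantitative tilt `quantTiltTransfer` proved, the reordered decl (cell radius `h` before the
amplitude `η₀`) follows from `EquilibriumRingLD` (stmt-AtomisticToContinuum-12130, verbatim) and the
eventual smallness `r_E(N) ≤ δ` of the equilibrium ring fraction (the Enskog-level re-aiming
estimate the item's informal text invokes), by `smallDataRingSparsity_hFirst_of`. [folklore] -/
theorem smallDataRingSparsity_hFirst_of_ringLD
    (hLD : Summit.AtomisticToContinuum.HydrodynamicLimit.Theses.RingDensityCertificate.EquilibriumRingLD)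
    (hSmall :
    ∀ θc : ℝ, 0 < θc → ∀ M : ℝ, 0 < M → ∀ δ : ℝ, 0 < δ → ∃ σ₀ : ℝ, 0 < σ₀ ∧ ∀ σ : ℝ, 0 < σ → σ < σ₀ → ∀ h : ℝ, 0 < h → ∀ (t : ℝ) (x₀ : UnitAddTorus (Fin 3)) (Φ : (N : ℕ) → Literature.Analysis.FluidPDE.HardSphereFlow (Literature.Analysis.FluidPDE.Torus.geometry (Fin 3)) (Literature.MathematicalPhysics.KineticTheory.hsDiameter σ N) (N + 1)), let w : ℕ → ℝ := fun N => M / (σ ^ 2 * (Real.sqrt (θc) * ((N + 1 : ℕ) : ℝ) ^ (1 / 3 : ℝ))); let Tc := fun (N : ℕ) (ε : ℝ) (γ : ℝ → Literature.Analysis.FluidPDE.Config (N + 1) (Fin 3) (UnitAddTorus (Fin 3))) (a ℓ r : ℝ) (i j : Fin (N + 1)) => {s : ℝ | s ∈ Set.Icc a (a + ℓ) ∧ γ s ∈ Literature.Analysis.FluidPDE.contactSet (Literature.Analysis.FluidPDE.Torus.geometry (Fin 3)) (N + 1) ε i j ∧ Literature.Analysis.FluidPDE.Torus.euclidDist (γ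 s i).1 x₀ < r}; let Bc := fun (N : ℕ) (ε : ℝ) (γ : ℝ → Literature.Analysis.FluidPDE.Config (N + 1) (Fin 3) (UnitAddTorus (Fin 3))) (a b : ℝ) (i : Fin (N + 1)) => {k : Fin (N + 1) | ∃ (m : ℕ) (p : Fin (m + 1) → Fin (N + 1)) (τ : Fin m → ℝ), p 0 = i ∧ p (Fin.last m) = k ∧ StrictAnti τ ∧ ∀ l : Fin m, τ l ∈ Set.Ico a b ∧ γ (τ l) ∈ Literature.Analysis.FluidPDE.contactSet (Literature.Analysis.FluidPDE.Torus.geometry (Fin 3)) (N + 1) ε (p l.castSucc) (p l.succ)}; let Zc := fun (N : ℕ) (ε : ℝ) (γ : ℝ → Literature.Analysis.FluidPDE.Config (N + 1) (Fin 3) (UnitAddTorus (Fin 3))) (a ℓ r : ℝ) => ∑ i : Fin (N + 1), ∑ j : Fin (N + 1), if i ≠ j then ∑ᶠ s ∈ Tc N ε γ a ℓ r i j, (1 : ℝ) else 0; let Zr := fun (N : ℕ) (ε : ℝ) (γ : ℝ → Literature.Analysis.FluidPDE.Config (N + 1) (Fin 3) (UnitAddTorus (Fin 3))) (a ℓ r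 : ℝ) => ∑ i : Fin (N + 1), ∑ j : Fin (N + 1), if i ≠ j then ∑ᶠ s ∈ Tc N ε γ a ℓ r i j, Set.indicator {s' : ℝ | ∃ k, k ∈ Bc N ε γ (s' - ℓ) s' i ∧ k ∈ Bc N ε γ (s' - ℓ) s' j} 1 s else 0; let rE : ℕ → ℝ := fun N => (∫ z, Zr N (Literature.MathematicalPhysics.KineticTheory.hsDiameter σ N) (fun s => (Φ N).flow s z) t (w N) h ∂Literature.MathematicalPhysics.KineticTheory.localGibbsLaw σ 1 0 (fun _ => θc) N (Φ N)) / (∫ z, Zc N (Literature.MathematicalPhysics.KineticTheory.hsDiameter σ N) (fun s => (Φ N).flow s z) t (w N) h ∂Literature.MathematicalPhysics.KineticTheory.localGibbsLaw σ 1 0 (fun _ => θc) N (Φ N)); ∀ᶠ N : ℕ in Filter.atTop, rE N ≤ δ) :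
    ∀ (c θc : ℝ), 0 < c → 0 < θc → ∀ M : ℝ, 0 < M → ∀ δ : ℝ, 0 < δ → ∃ σ₀ : ℝ, 0 < σ₀ ∧ ∀ σ : ℝ, 0 < σ → σ < σ₀ → ∀ h : ℝ, 0 < h → ∃ η₀ : ℝ, 0 < η₀ ∧ ∀ (a₀ θ₀ : UnitAddTorus (Fin 3) → ℝ) (u₀ : UnitAddTorus (Fin 3) → EuclideanSpace ℝ (Fin 3)), Continuous a₀ → Continuous θ₀ → Continuous u₀ → (∀ x, 0 < a₀ x) → (∀ x, 0 < θ₀ x) → (∀ x, |a₀ x - c| ≤ η₀ ∧ ‖u₀ x‖ ≤ η₀ ∧ |θ₀ x - θc| ≤ η₀) → ∀ Φ : (N : ℕ) → Literature.Analysis.FluidPDE.HardSphereFlow (Literature.Analysis.FluidPDE.Torus.geometry (Fin 3)) (Literature.MathematicalPhysics.KineticTheory.hsDiameter σ N) (N + 1), ∀ (t : ℝ) (x₀ : UnitAddTorus (Fin 3)), let w : ℕ → ℝ := fun N => M / (σ ^ 2 * (Real.sqrt (θc) * ((N + 1 : ℕ) : ℝ) ^ (1 / 3 : ℝ))); let Tc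 := fun (N : ℕ) (ε : ℝ) (γ : ℝ → Literature.Analysis.FluidPDE.Config (N + 1) (Fin 3) (UnitAddTorus (Fin 3))) (a ℓ r : ℝ) (i j : Fin (N + 1)) => {s : ℝ | s ∈ Set.Icc a (a + ℓ) ∧ γ s ∈ Literature.Analysis.FluidPDE.contactSet (Literature.Analysis.FluidPDE.Torus.geometry (Fin 3)) (N + 1) ε i j ∧ Literature.Analysis.FluidPDE.Torus.euclidDist (γ s i).1 x₀ < r}; let Bc := fun (N : ℕ) (ε : ℝ) (γ : ℝ → Literature.Analysis.FluidPDE.Config (N + 1) (Fin 3) (UnitAddTorus (Fin 3))) (a b : ℝ) (i : Fin (N + 1)) => {k : Fin (N + 1) | ∃ (m : ℕ) (p : Fin (m + 1) → Fin (N + 1)) (τ : Fin m → ℝ), p 0 = i ∧ p (Fin.last m) = k ∧ StrictAnti τ ∧ ∀ l : Fin m, τ l ∈ Set.Ico a b ∧ γ (τ l) ∈ Literature.Analysis.FluidPDE.contactSet (Literature.Analysis.FluidPDE.Torus.geometry (Fin 3)) (N + 1) ε (p l.castSucc) (p l.succ)}; let Zc := fun (N : ℕ) (ε : ℝ) (γ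 : ℝ → Literature.Analysis.FluidPDE.Config (N + 1) (Fin 3) (UnitAddTorus (Fin 3))) (a ℓ r : ℝ) => ∑ i : Fin (N + 1), ∑ j : Fin (N + 1), if i ≠ j then ∑ᶠ s ∈ Tc N ε γ a ℓ r i j, (1 : ℝ) else 0; let Zr := fun (N : ℕ) (ε : ℝ) (γ : ℝ → Literature.Analysis.FluidPDE.Config (N + 1) (Fin 3) (UnitAddTorus (Fin 3))) (a ℓ r : ℝ) => ∑ i : Fin (N + 1), ∑ j : Fin (N + 1), if i ≠ j then ∑ᶠ s ∈ Tc N ε γ a ℓ r i j, Set.indicator {s' : ℝ | ∃ k, k ∈ Bc N ε γ (s' - ℓ) s' i ∧ k ∈ Bc N ε γ (s' - ℓ) s' j} 1 s else 0; Filter.Tendsto (fun N : ℕ => Literature.MathematicalPhysics.KineticTheory.localGibbsLaw σ a₀ u₀ θ₀ N (Φ N) {z | δ * Zc N (Literature.MathematicalPhysics.KineticTheory.hsDiameter σ N) (fun s => (Φ N).flow s z) t (w N) h < Zr N (Literature.MathematicalPhysics.KineticTheory.hsDiameter σ N) (fun s => (Φ N).flow s z) t (w N) h}) Filter.atTop (nhds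 0) :=
  smallDataRingSparsity_hFirst_of hLD quantTiltTransfer hSmall

/-- **`SmallDataRingSparsity`, `h`-first form, from ONE equilibrium large-deviation input.** The
alternative repair for the planner: if the equilibrium large deviations are filed directly for the
ring-EXCESS event `{δ·Z_coll < Z_ring}` (i.e. `EquilibriumRingLD` with the centring `r_E(N)`
absorbed: for `σ < σ₀(θc, M, δ)` the equilibrium ring fraction is below `δ` with extensive
exponential probability), then the reordered decl follows from that single hypothesis and the
proved quantitative tilt (`tendsto_measure_of_ld_of_tilt` with `A_N = B_N`). [folklore] -/
theorem smallDataRingSparsity_hFirst_of_sparsityLD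
    (hLDS :
    ∀ θc : ℝ, 0 < θc → ∀ M : ℝ, 0 < M → ∀ δ : ℝ, 0 < δ → ∃ σ₀ : ℝ, 0 < σ₀ ∧ ∀ σ : ℝ, 0 < σ → σ < σ₀ → ∀ h : ℝ, 0 < h → ∃ C : ℝ, 0 < C ∧ ∀ (t : ℝ) (x₀ : UnitAddTorus (Fin 3)) (Φ : (N : ℕ) → Literature.Analysis.FluidPDE.HardSphereFlow (Literature.Analysis.FluidPDE.Torus.geometry (Fin 3)) (Literature.MathematicalPhysics.KineticTheory.hsDiameter σ N) (N + 1)), let w : ℕ → ℝ := fun N => M / (σ ^ 2 * (Real.sqrt (θc) * ((N + 1 : ℕ) : ℝ) ^ (1 / 3 : ℝ))); let Tc := fun (N : ℕ) (ε : ℝ) (γ : ℝ → Literature.Analysis.FluidPDE.Config (N + 1) (Fin 3) (UnitAddTorus (Fin 3))) (a ℓ r : ℝ) (i j : Fin (N + 1)) => {s : ℝ | s ∈ Set.Icc a (a + ℓ) ∧ γ s ∈ Literature.Analysis.FluidPDE.contactSet (Literature.Analysis.FluidPDE.Torus.geometry (Fin 3)) (N + 1) ε i j ∧ Literature.Analysis.FluidPDE.Torus.euclidDist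 (γ s i).1 x₀ < r}; let Bc := fun (N : ℕ) (ε : ℝ) (γ : ℝ → Literature.Analysis.FluidPDE.Config (N + 1) (Fin 3) (UnitAddTorus (Fin 3))) (a b : ℝ) (i : Fin (N + 1)) => {k : Fin (N + 1) | ∃ (m : ℕ) (p : Fin (m + 1) → Fin (N + 1)) (τ : Fin m → ℝ), p 0 = i ∧ p (Fin.last m) = k ∧ StrictAnti τ ∧ ∀ l : Fin m, τ l ∈ Set.Ico a b ∧ γ (τ l) ∈ Literature.Analysis.FluidPDE.contactSet (Literature.Analysis.FluidPDE.Torus.geometry (Fin 3)) (N + 1) ε (p l.castSucc) (p l.succ)}; let Zc := fun (N : ℕ) (ε : ℝ) (γ : ℝ → Literature.Analysis.FluidPDE.Config (N + 1) (Fin 3) (UnitAddTorus (Fin 3))) (a ℓ r : ℝ) => ∑ i : Fin (N + 1), ∑ j : Fin (N + 1), if i ≠ j then ∑ᶠ s ∈ Tc N ε γ a ℓ r i j, (1 : ℝ) else 0; let Zr := fun (N : ℕ) (ε : ℝ) (γ : ℝ → Literature.Analysis.FluidPDE.Config (N + 1) (Fin 3) (UnitAddTorus (Fin 3))) (a ℓ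 r : ℝ) => ∑ i : Fin (N + 1), ∑ j : Fin (N + 1), if i ≠ j then ∑ᶠ s ∈ Tc N ε γ a ℓ r i j, Set.indicator {s' : ℝ | ∃ k, k ∈ Bc N ε γ (s' - ℓ) s' i ∧ k ∈ Bc N ε γ (s' - ℓ) s' j} 1 s else 0; ∀ N : ℕ, Literature.MathematicalPhysics.KineticTheory.localGibbsLaw σ 1 0 (fun _ => θc) N (Φ N) {z | δ * Zc N (Literature.MathematicalPhysics.KineticTheory.hsDiameter σ N) (fun s => (Φ N).flow s z) t (w N) h < Zr N (Literature.MathematicalPhysics.KineticTheory.hsDiameter σ N) (fun s => (Φ N).flow s z) t (w N) h} ≤ ENNReal.ofReal (C * Real.exp (-(C⁻¹ * (N + 1))))) :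
    ∀ (c θc : ℝ), 0 < c → 0 < θc → ∀ M : ℝ, 0 < M → ∀ δ : ℝ, 0 < δ → ∃ σ₀ : ℝ, 0 < σ₀ ∧ ∀ σ : ℝ, 0 < σ → σ < σ₀ → ∀ h : ℝ, 0 < h → ∃ η₀ : ℝ, 0 < η₀ ∧ ∀ (a₀ θ₀ : UnitAddTorus (Fin 3) → ℝ) (u₀ : UnitAddTorus (Fin 3) → EuclideanSpace ℝ (Fin 3)), Continuous a₀ → Continuous θ₀ → Continuous u₀ → (∀ x, 0 < a₀ x) → (∀ x, 0 < θ₀ x) → (∀ x, |a₀ x - c| ≤ η₀ ∧ ‖u₀ x‖ ≤ η₀ ∧ |θ₀ x - θc| ≤ η₀) → ∀ Φ : (N : ℕ) → Literature.Analysis.FluidPDE.HardSphereFlow (Literature.Analysis.FluidPDE.Torus.geometry (Fin 3)) (Literature.MathematicalPhysics.KineticTheory.hsDiameter σ N) (N + 1), ∀ (t : ℝ) (x₀ : UnitAddTorus (Fin 3)), let w : ℕ → ℝ := fun N => M / (σ ^ 2 * (Real.sqrt (θc) * ((N + 1 : ℕ) : ℝ) ^ (1 / 3 : ℝ))); let Tc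 := fun (N : ℕ) (ε : ℝ) (γ : ℝ → Literature.Analysis.FluidPDE.Config (N + 1) (Fin 3) (UnitAddTorus (Fin 3))) (a ℓ r : ℝ) (i j : Fin (N + 1)) => {s : ℝ | s ∈ Set.Icc a (a + ℓ) ∧ γ s ∈ Literature.Analysis.FluidPDE.contactSet (Literature.Analysis.FluidPDE.Torus.geometry (Fin 3)) (N + 1) ε i j ∧ Literature.Analysis.FluidPDE.Torus.euclidDist (γ s i).1 x₀ < r}; let Bc := fun (N : ℕ) (ε : ℝ) (γ : ℝ → Literature.Analysis.FluidPDE.Config (N + 1) (Fin 3) (UnitAddTorus (Fin 3))) (a b : ℝ) (i : Fin (N + 1)) => {k : Fin (N + 1) | ∃ (m : ℕ) (p : Fin (m + 1) → Fin (N + 1)) (τ : Fin m → ℝ), p 0 = i ∧ p (Fin.last m) = k ∧ StrictAnti τ ∧ ∀ l : Fin m, τ l ∈ Set.Ico a b ∧ γ (τ l) ∈ Literature.Analysis.FluidPDE.contactSet (Literature.Analysis.FluidPDE.Torus.geometry (Fin 3)) (N + 1) ε (p l.castSucc) (p l.succ)}; let Zc := fun (N : ℕ) (ε : ℝ) (γ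 : ℝ → Literature.Analysis.FluidPDE.Config (N + 1) (Fin 3) (UnitAddTorus (Fin 3))) (a ℓ r : ℝ) => ∑ i : Fin (N + 1), ∑ j : Fin (N + 1), if i ≠ j then ∑ᶠ s ∈ Tc N ε γ a ℓ r i j, (1 : ℝ) else 0; let Zr := fun (N : ℕ) (ε : ℝ) (γ : ℝ → Literature.Analysis.FluidPDE.Config (N + 1) (Fin 3) (UnitAddTorus (Fin 3))) (a ℓ r : ℝ) => ∑ i : Fin (N + 1), ∑ j : Fin (N + 1), if i ≠ j then ∑ᶠ s ∈ Tc N ε γ a ℓ r i j, Set.indicator {s' : ℝ | ∃ k, k ∈ Bc N ε γ (s' - ℓ) s' i ∧ k ∈ Bc N ε γ (s' - ℓ) s' j} 1 s else 0; Filter.Tendsto (fun N : ℕ => Literature.MathematicalPhysics.KineticTheory.localGibbsLaw σ a₀ u₀ θ₀ N (Φ N) {z | δ * Zc N (Literature.MathematicalPhysics.KineticTheory.hsDiameter σ N) (fun s => (Φ N).flow s z) t (w N) h < Zr N (Literature.MathematicalPhysics.KineticTheory.hsDiameter σ N) (fun s => (Φ N).flow s z) t (w N) h}) Filter.atTop (nhds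 0) := by
  intro c θc hc hθc M hM δ hδ
  obtain ⟨σ₁, hσ₁, h₁⟩ := hLDS θc hθc M hM δ hδ
  refine ⟨min σ₁ (1 / 4), by positivity, ?_⟩
  intro σ hσ hσlt h hh
  have hσ₁' : σ < σ₁ := lt_of_lt_of_le hσlt (min_le_left _ _)
  have hσ4 : σ < 1 / 4 := lt_of_lt_of_le hσlt (min_le_right _ _)
  obtain ⟨C, hC, hCb⟩ := h₁ σ hσ hσ₁' h hh
  have hΛ : (0 : ℝ) < 1 / (4 * C) := by positivity
  obtain ⟨η₀, hη₀, hη⟩ := quantTiltTransfer c θc σ hc hθc hσ hσ4 (1 / (4 * C)) hΛ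
  refine ⟨η₀, hη₀, ?_⟩
  intro a₀ θ₀ u₀ ha hθ hu ha0 hθ0 hclose Φ t x₀
  have hB := hCb t x₀ Φ
  dsimp only at hB ⊢
  refine tendsto_measure_of_ld_of_tilt (Λ := 1 / (4 * C))
    (fun N => Literature.MathematicalPhysics.KineticTheory.localGibbsLaw σ a₀ u₀ θ₀ N (Φ N))
    (fun N => Literature.MathematicalPhysics.KineticTheory.localGibbsLaw σ 1 0 (fun _ => θc) N (Φ N))
    _ _ hC ?_ (Eventually.of_forall fun N => subset_rfl) hB ?_
  · rw [one_div_lt_one_div (by positivity) (by positivity)]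
    linarith
  · intro N S hSm
    exact hη a₀ θ₀ u₀ ha hθ hu ha0 hθ0 hclose N (Φ N) S hSm

end SmallDataRingSparsity

end Summit.AtomisticToContinuum.HydrodynamicLimit.Theorems

end
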